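import Literature.Analysis.FunctionSpaces.TorusGevreyCompactness
import HarnessLib

/-!
# Sup-norm and Sobolev bounds of smooth fields on `T^d` from a Gevrey bound on the coefficients

Analysis/FunctionSpaces support file (everything proved; no definitions, no named facts), companion of
`TorusGevreyCompactness.lean`. A smooth real vector field `v : T^d → ℝ^d` whose Fourier coefficients
`v̂(k) = 𝓕(complexify ∘ v)(k)` obey the **Gevrey bound**
`∑_{k ∈ S} e^{2σ|k|} ‖v̂(k)‖² ≤ C` for all finite `S ⊆ ℤ^d` (`σ > 0`, `|k| = (freqNormSq k)^{1/2}`; the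
Gevrey classes `D(e^{σA^{1/2}})` of Foias–Temam 1989) is bounded in every classical norm by a constant
`B(σ, C, d)`: here we record the sup norms of `v`, `∂ᵢv`, `Δv`, `∂ᵢΔv`, the squared gradient norms
`‖∇v‖₂²`, `‖∇Δv‖₂²`, the `L²` norm `‖Δv‖₂²` and the fourth Sobolev sums `∑_{k∈S} (1 + |k|²)⁴ ‖v̂(k)‖²`
(`Torus.exists_sobolevBounds_of_gevreyBound`). These are the classical consequences of uniform
analyticity-radius bounds on bounded-enstrophy Navier–Stokes trajectories consumed by continuation and
linearisation arguments.

## The proof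

1. *Modewise* (`Torus.norm_sq_le_mul_exp_neg_of_gevreyBound`, `Torus.norm_le_sqrt_mul_exp_neg_of_gevreyBound`):
   `S = {k}` gives `‖v̂(k)‖² ≤ C e^{-2σ|k|}`, `‖v̂(k)‖ ≤ √C e^{-σ|k|}` (and `S = ∅` gives `0 ≤ C`).
2. *Weights*: `∑ₖ (1 + |k|²)^m e^{-a|k|} < ∞` for every `m` and `a > 0`
   (`Torus.summable_one_add_freqNormSq_pow_mul_exp_neg` of `TorusGevreyCompactness`), whence the weighted
   `ℓ¹` bounds `∑ₖ (1 + |k|²)^m ‖v̂(k)‖ ≤ √C ∑ₖ (1 + |k|²)^m e^{-σ|k|}`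
   (`Torus.tsum_one_add_freqNormSq_pow_mul_norm_le_of_gevreyBound`) and the Sobolev sums
   `∑_{k∈S} (1 + |k|²)^m ‖v̂(k)‖² ≤ C ∑ₖ (1 + |k|²)^m e^{-2σ|k|}`
   (`Torus.sum_one_add_freqNormSq_pow_mul_norm_sq_le_of_gevreyBound`).
3. *Sup norms*: the Fourier series of a smooth field converges to it pointwise
   (`Torus.hasSum_mFourier_smul_mFourierCoeff`, Grafakos 2014, Prop. 3.2.5), so `‖a(x)‖ ≤ ∑ₖ ‖â(k)‖`
   (`Torus.norm_apply_le_tsum_norm_mFourierCoeff`); applied to `a = v, ∂ᵢv, Δv, ∂ᵢΔv`, whose coefficients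
   carry the symbols `2πi kᵢ`, `-4π²|k|²` (`Torus.mFourierCoeff_complexify_partialDeriv`,
   `Torus.mFourierCoeff_complexify_laplacian`; Grafakos 2014, Prop. 3.2.6 (8)) of size `≤ 2π(1 + |k|²)`,
   `≤ 4π²(1 + |k|²)`.
4. *`L²` quantities* on the probability space `T^d`: `∫ ‖g‖² ≤ (sup ‖g‖)²` and
   `‖∇a‖₂² = ∫ ∑ᵢ ‖∂ᵢa‖² ≤ #d · (sup_{i,x} ‖∂ᵢa(x)‖)²`.

## Mathlib / tree search

Tree (reused): `Torus.one_add_sq_pow_mul_exp_neg_le`, `Torus.summable_one_add_freqNormSq_pow_mul_exp_neg`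
(`TorusGevreyCompactness`), `Torus.hasSum_mFourier_smul_mFourierCoeff`,
`Torus.summable_norm_mFourierCoeff_of_isSmooth` (`TorusFourierSeries`), `Torus.norm_mFourier_smul`,
`Torus.abs_apply_le_one_add_freqNormSq` (`TorusFourierSynthesis`), `Torus.mFourierCoeff_complexify_partialDeriv`
(`TorusTrigPoly`), `Torus.mFourierCoeff_complexify_laplacian` (`TorusFourierModes`),
`EuclideanSpace.norm_complexify`; Mathlib `norm_tsum_le_tsum_norm`, `Summable.tsum_le_tsum`,
`Summable.sum_le_tsum`, `integral_mono_of_nonneg`. Searched `Gevrey`, `exp.*sqrt (freqNormSq`,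
`norm_apply_le_tsum`, `partialDeriv.*le.*tsum` in the tree: only the compactness file above (no sup/Sobolev
bounds from a Gevrey bound); `TorusSobolevSup` bounds sup norms by `H²` norms in `d ≤ 3` instead.

## References

* C. Foias, R. Temam, *Gevrey class regularity for the solutions of the Navier–Stokes equations*,
  J. Funct. Anal. 87 (1989), 359–369 (the Gevrey classes `D(e^{σA^{1/2}})`). [FoiasTemam1989]
* L. Grafakos, *Classical Fourier Analysis*, 3rd ed., GTM 249 (2014), Prop. 3.2.5 (inversion),
  Prop. 3.2.6 (8) (symbols of derivatives), §3.3.3. [Grafakos2014]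
-/

noncomputable section

open _root_.MeasureTheory Set Filter Function UnitAddTorus
open scoped Topology ENNReal BigOperators

namespace Literature.Analysis.FunctionSpaces

namespace Torus

variable {d : Type*} [Fintype d]

/-! ### Modewise consequences of a Gevrey bound -/

section Modewise

variable {V : Type*} [NormedAddCommGroup V] {σ C : ℝ} {c : (d → ℤ) → V}

/-- The constant of a Gevrey bound `∑_{k∈S} e^{2σ|k|} ‖c k‖² ≤ C` (all finite `S`) is nonnegative
(`S = ∅`). [folklore] -/
theorem gevreyBound_nonneg
    (h : ∀ S : Finset (d → ℤ), ∑ k ∈ S, Real.exp (2 * σ * Real.sqrt (freqNormSq k)) * ‖c k‖ ^ 2 ≤ C) :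
    0 ≤ C := by
  simpa using h ∅

/-- **Modewise Gevrey decay**: `∑_{k∈S} e^{2σ|k|} ‖c k‖² ≤ C` for all finite `S` gives
`‖c k‖² ≤ C e^{-2σ|k|}` (`S = {k}`). [folklore] -/
theorem norm_sq_le_mul_exp_neg_of_gevreyBound
    (h : ∀ S : Finset (d → ℤ), ∑ k ∈ S, Real.exp (2 * σ * Real.sqrt (freqNormSq k)) * ‖c k‖ ^ 2 ≤ C)
    (k : d → ℤ) : ‖c k‖ ^ 2 ≤ C * Real.exp (-(2 * σ * Real.sqrt (freqNormSq k))) := by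
  have hk : Real.exp (2 * σ * Real.sqrt (freqNormSq k)) * ‖c k‖ ^ 2 ≤ C := by simpa using h {k}
  rw [Real.exp_neg, ← div_eq_mul_inv, le_div_iff₀ (Real.exp_pos _), mul_comm]
  exact hk

/-- **Modewise Gevrey decay, square-root form**: `‖c k‖ ≤ √C e^{-σ|k|}`. [folklore] -/
theorem norm_le_sqrt_mul_exp_neg_of_gevreyBound
    (h : ∀ S : Finset (d → ℤ), ∑ k ∈ S, Real.exp (2 * σ * Real.sqrt (freqNormSq k)) * ‖c k‖ ^ 2 ≤ C)
    (k : d → ℤ) : ‖c k‖ ≤ Real.sqrt C * Real.exp (-(σ * Real.sqrt (freqNormSq k))) := by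
  -- adapted from the proof of `Torus.rapidDecay_of_norm_sq_le_mul_exp_neg` (`TorusGevreyCompactness`)
  have hC : 0 ≤ C := gevreyBound_nonneg h
  have hsq : C * Real.exp (-(2 * σ * Real.sqrt (freqNormSq k))) =
      (Real.sqrt C * Real.exp (-(σ * Real.sqrt (freqNormSq k)))) ^ 2 := by
    rw [mul_pow, Real.sq_sqrt hC, sq, ← Real.exp_add]
    ring_nf
  have h' := norm_sq_le_mul_exp_neg_of_gevreyBound h k
  rw [hsq] at h'
  exact (pow_le_pow_iff_left₀ (norm_nonneg _) (by positivity) two_ne_zero).1 h'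

/-- Polynomially weighted modewise bound: `(1 + |k|²)^m ‖c k‖ ≤ √C (1 + |k|²)^m e^{-σ|k|}`. [folklore] -/
theorem one_add_freqNormSq_pow_mul_norm_le_of_gevreyBound
    (h : ∀ S : Finset (d → ℤ), ∑ k ∈ S, Real.exp (2 * σ * Real.sqrt (freqNormSq k)) * ‖c k‖ ^ 2 ≤ C)
    (m : ℕ) (k : d → ℤ) :
    (1 + freqNormSq k) ^ m * ‖c k‖ ≤
      Real.sqrt C * ((1 + freqNormSq k) ^ m * Real.exp (-(σ * Real.sqrt (freqNormSq k)))) := by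
  calc (1 + freqNormSq k) ^ m * ‖c k‖
      ≤ (1 + freqNormSq k) ^ m * (Real.sqrt C * Real.exp (-(σ * Real.sqrt (freqNormSq k)))) :=
        mul_le_mul_of_nonneg_left (norm_le_sqrt_mul_exp_neg_of_gevreyBound h k)
          (one_add_freqNormSq_pow_nonneg k m)
    _ = Real.sqrt C * ((1 + freqNormSq k) ^ m * Real.exp (-(σ * Real.sqrt (freqNormSq k)))) := by ring

/-- Polynomially weighted modewise bound for squares:
`(1 + |k|²)^m ‖c k‖² ≤ C (1 + |k|²)^m e^{-2σ|k|}`. [folklore] -/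
theorem one_add_freqNormSq_pow_mul_norm_sq_le_of_gevreyBound
    (h : ∀ S : Finset (d → ℤ), ∑ k ∈ S, Real.exp (2 * σ * Real.sqrt (freqNormSq k)) * ‖c k‖ ^ 2 ≤ C)
    (m : ℕ) (k : d → ℤ) :
    (1 + freqNormSq k) ^ m * ‖c k‖ ^ 2 ≤
      C * ((1 + freqNormSq k) ^ m * Real.exp (-(2 * σ * Real.sqrt (freqNormSq k)))) := by
  calc (1 + freqNormSq k) ^ m * ‖c k‖ ^ 2
      ≤ (1 + freqNormSq k) ^ m * (C * Real.exp (-(2 * σ * Real.sqrt (freqNormSq k)))) :=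
        mul_le_mul_of_nonneg_left (norm_sq_le_mul_exp_neg_of_gevreyBound h k)
          (one_add_freqNormSq_pow_nonneg k m)
    _ = C * ((1 + freqNormSq k) ^ m * Real.exp (-(2 * σ * Real.sqrt (freqNormSq k)))) := by ring

/-- **Gevrey bounds give rapid decay, quantitatively (summability)**: `∑ₖ (1 + |k|²)^m ‖c k‖ < ∞`
for every `m` (comparison with `√C ∑ₖ (1 + |k|²)^m e^{-σ|k|}`). [folklore] -/
theorem summable_one_add_freqNormSq_pow_mul_norm_of_gevreyBound (hσ : 0 < σ)
    (h : ∀ S : Finset (d → ℤ), ∑ k ∈ S, Real.exp (2 * σ * Real.sqrt (freqNormSq k)) * ‖c k‖ ^ 2 ≤ C)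
    (m : ℕ) : Summable fun k : d → ℤ => (1 + freqNormSq k) ^ m * ‖c k‖ :=
  Summable.of_nonneg_of_le (fun k => mul_nonneg (one_add_freqNormSq_pow_nonneg k m) (norm_nonneg _))
    (fun k => one_add_freqNormSq_pow_mul_norm_le_of_gevreyBound h m k)
    ((summable_one_add_freqNormSq_pow_mul_exp_neg hσ m).mul_left (Real.sqrt C))

/-- **Weighted `ℓ¹` bound under a Gevrey bound**:
`∑ₖ (1 + |k|²)^m ‖c k‖ ≤ √C · ∑ₖ (1 + |k|²)^m e^{-σ|k|}`. [folklore] -/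
theorem tsum_one_add_freqNormSq_pow_mul_norm_le_of_gevreyBound (hσ : 0 < σ)
    (h : ∀ S : Finset (d → ℤ), ∑ k ∈ S, Real.exp (2 * σ * Real.sqrt (freqNormSq k)) * ‖c k‖ ^ 2 ≤ C)
    (m : ℕ) :
    ∑' k : d → ℤ, (1 + freqNormSq k) ^ m * ‖c k‖ ≤
      Real.sqrt C * ∑' k : d → ℤ, (1 + freqNormSq k) ^ m * Real.exp (-(σ * Real.sqrt (freqNormSq k))) := by
  rw [← tsum_mul_left]
  exact Summable.tsum_le_tsum (fun k => one_add_freqNormSq_pow_mul_norm_le_of_gevreyBound h m k)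
    (summable_one_add_freqNormSq_pow_mul_norm_of_gevreyBound hσ h m)
    ((summable_one_add_freqNormSq_pow_mul_exp_neg hσ m).mul_left (Real.sqrt C))

/-- **Sobolev sums under a Gevrey bound**: for every finite `S ⊆ ℤ^d` and every `m`,
`∑_{k∈S} (1 + |k|²)^m ‖c k‖² ≤ C · ∑ₖ (1 + |k|²)^m e^{-2σ|k|}`. [folklore] -/
theorem sum_one_add_freqNormSq_pow_mul_norm_sq_le_of_gevreyBound (hσ : 0 < σ)
    (h : ∀ S : Finset (d → ℤ), ∑ k ∈ S, Real.exp (2 * σ * Real.sqrt (freqNormSq k)) * ‖c k‖ ^ 2 ≤ C)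
    (m : ℕ) (S : Finset (d → ℤ)) :
    ∑ k ∈ S, (1 + freqNormSq k) ^ m * ‖c k‖ ^ 2 ≤
      C * ∑' k : d → ℤ, (1 + freqNormSq k) ^ m * Real.exp (-(2 * σ * Real.sqrt (freqNormSq k))) := by
  have hs := summable_one_add_freqNormSq_pow_mul_exp_neg (d := d) (mul_pos two_pos hσ) m
  calc ∑ k ∈ S, (1 + freqNormSq k) ^ m * ‖c k‖ ^ 2
      ≤ ∑ k ∈ S, C * ((1 + freqNormSq k) ^ m * Real.exp (-(2 * σ * Real.sqrt (freqNormSq k)))) :=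
        Finset.sum_le_sum fun k _ => one_add_freqNormSq_pow_mul_norm_sq_le_of_gevreyBound h m k
    _ = C * ∑ k ∈ S, (1 + freqNormSq k) ^ m * Real.exp (-(2 * σ * Real.sqrt (freqNormSq k))) := by
        rw [Finset.mul_sum]
    _ ≤ C * ∑' k : d → ℤ, (1 + freqNormSq k) ^ m * Real.exp (-(2 * σ * Real.sqrt (freqNormSq k))) :=
        mul_le_mul_of_nonneg_left
          (hs.sum_le_tsum S fun k _ => mul_nonneg (one_add_freqNormSq_pow_nonneg k m) (Real.exp_pos _).le)
          (gevreyBound_nonneg h)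

end Modewise

/-! ### `L²` quantities from sup bounds on the probability space `T^d` -/

section L2

/-- `∫ ‖g‖² ≤ M²` on `T^d` (volume one) if `‖g x‖ ≤ M` for all `x`. [folklore] -/
theorem integral_norm_sq_le_of_forall_norm_le {E : Type*} [NormedAddCommGroup E]
    {g : UnitAddTorus d → E} {M : ℝ} (hM : ∀ x, ‖g x‖ ≤ M) : ∫ x, ‖g x‖ ^ 2 ≤ M ^ 2 := by
  have h1 : ∫ x, ‖g x‖ ^ 2 ≤ ∫ _ : UnitAddTorus d, M ^ 2 :=
    integral_mono_of_nonneg (ae_of_all _ fun x => sq_nonneg _) (integrable_const _)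
      (ae_of_all _ fun x => pow_le_pow_left₀ (norm_nonneg _) (hM x) 2)
  simpa using h1

variable [DecidableEq d]

/-- `‖∇a‖₂² = ∫ ∑ᵢ ‖∂ᵢa‖² ≤ #d · M²` on `T^d` (volume one) if `‖∂ᵢ a x‖ ≤ M` for all `i`, `x`. [folklore] -/
theorem gradNormSq_le_of_forall_norm_partialDeriv_le {a : UnitAddTorus d → EuclideanSpace ℝ d} {M : ℝ}
    (hM : ∀ i x, ‖partialDeriv i a x‖ ≤ M) : gradNormSq a ≤ Fintype.card d * M ^ 2 := by
  have hpt : ∀ x, ∑ i, ‖partialDeriv i a x‖ ^ 2 ≤ Fintype.card d * M ^ 2 := fun x => by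
    calc ∑ i, ‖partialDeriv i a x‖ ^ 2 ≤ ∑ _i : d, M ^ 2 :=
          Finset.sum_le_sum fun i _ => pow_le_pow_left₀ (norm_nonneg _) (hM i x) 2
      _ = Fintype.card d * M ^ 2 := by rw [Finset.sum_const, Finset.card_univ, nsmul_eq_mul]
  have h1 : ∫ x, ∑ i, ‖partialDeriv i a x‖ ^ 2 ≤ ∫ _ : UnitAddTorus d, (Fintype.card d * M ^ 2 : ℝ) :=
    integral_mono_of_nonneg (ae_of_all _ fun x => Finset.sum_nonneg fun i _ => sq_nonneg _)
      (integrable_const _) (ae_of_all _ hpt)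
  rw [gradNormSq]
  simpa using h1

end L2

/-! ### Sup norms of smooth fields through their Fourier coefficients -/

section Sup

variable [DecidableEq d] {a : UnitAddTorus d → EuclideanSpace ℝ d}

/-- **Sup norm by the `ℓ¹` norm of the coefficients**: `‖a(x)‖ ≤ ∑ₖ ‖â(k)‖` for a smooth real vector
field on `T^d` (pointwise Fourier inversion `complexify (a x) = ∑ₖ e_k(x) â(k)`, `|e_k(x)| = 1`;
Grafakos 2014, Prop. 3.2.5). [folklore] -/
theorem norm_apply_le_tsum_norm_mFourierCoeff (ha : IsSmooth a) (x : UnitAddTorus d) :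
    ‖a x‖ ≤ ∑' k : d → ℤ, ‖mFourierCoeff (EuclideanSpace.complexify ∘ a) k‖ := by
  have h := hasSum_mFourier_smul_mFourierCoeff ha x
  have hs : Summable fun k : d → ℤ =>
      ‖mFourier k x • mFourierCoeff (EuclideanSpace.complexify ∘ a) k‖ :=
    (summable_norm_mFourierCoeff_of_isSmooth ha).congr fun k => (norm_mFourier_smul k x _).symm
  rw [← EuclideanSpace.norm_complexify, ← h.tsum_eq]
  exact (norm_tsum_le_tsum_norm hs).trans (le_of_eq (tsum_congr fun k => norm_mFourier_smul k x _))

/-- Symbol bound for first derivatives: `‖𝓕(complexify ∘ ∂ⱼa)(k)‖ ≤ 2π (1 + |k|²) ‖â(k)‖`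
(`𝓕(∂ⱼa)(k) = 2πi kⱼ â(k)`, `|kⱼ| ≤ 1 + |k|²`; Grafakos 2014, Prop. 3.2.6 (8)). [folklore] -/
theorem norm_mFourierCoeff_complexify_partialDeriv_le (ha : IsSmooth a) (j : d) (k : d → ℤ) :
    ‖mFourierCoeff (EuclideanSpace.complexify ∘ partialDeriv j a) k‖ ≤
      2 * Real.pi * (1 + freqNormSq k) * ‖mFourierCoeff (EuclideanSpace.complexify ∘ a) k‖ := by
  -- adapted from `Torus.RapidDecay.deriv` (`TorusFourierSynthesis`)
  rw [mFourierCoeff_complexify_partialDeriv ha j k, norm_smul]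
  have hn : ‖(2 * Real.pi * Complex.I * (k j) : ℂ)‖ = 2 * Real.pi * |(k j : ℝ)| := by
    simp [abs_of_pos Real.pi_pos]
  rw [hn]
  exact mul_le_mul_of_nonneg_right
    (mul_le_mul_of_nonneg_left (abs_apply_le_one_add_freqNormSq k j) (by positivity)) (norm_nonneg _)

/-- Symbol bound for the Laplacian: `‖𝓕(complexify ∘ Δa)(k)‖ ≤ 4π² (1 + |k|²) ‖â(k)‖`
(`𝓕(Δa)(k) = -4π²|k|² â(k)`; Grafakos 2014, Prop. 3.2.6 (8)). [folklore] -/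
theorem norm_mFourierCoeff_complexify_laplacian_le (ha : IsSmooth a) (k : d → ℤ) :
    ‖mFourierCoeff (EuclideanSpace.complexify ∘ laplacian a) k‖ ≤
      4 * Real.pi ^ 2 * (1 + freqNormSq k) * ‖mFourierCoeff (EuclideanSpace.complexify ∘ a) k‖ := by
  have h0 : 0 ≤ 4 * Real.pi ^ 2 * freqNormSq k := by
    have := freqNormSq_nonneg k
    positivity
  rw [mFourierCoeff_complexify_laplacian ha k, norm_neg, norm_smul, Complex.norm_real,
    Real.norm_of_nonneg h0]
  refine mul_le_mul_of_nonneg_right (mul_le_mul_of_nonneg_left ?_ (by positivity)) (norm_nonneg _)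
  linarith [freqNormSq_nonneg k]

/-- Symbol bound for third derivatives: `‖𝓕(complexify ∘ ∂ⱼΔa)(k)‖ ≤ 8π³ (1 + |k|²)² ‖â(k)‖`. [folklore] -/
theorem norm_mFourierCoeff_complexify_partialDeriv_laplacian_le (ha : IsSmooth a) (j : d) (k : d → ℤ) :
    ‖mFourierCoeff (EuclideanSpace.complexify ∘ partialDeriv j (laplacian a)) k‖ ≤
      8 * Real.pi ^ 3 * (1 + freqNormSq k) ^ 2 * ‖mFourierCoeff (EuclideanSpace.complexify ∘ a) k‖ := by
  have hw : 0 ≤ 2 * Real.pi * (1 + freqNormSq k) := by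
    have := freqNormSq_nonneg k
    positivity
  calc ‖mFourierCoeff (EuclideanSpace.complexify ∘ partialDeriv j (laplacian a)) k‖
      ≤ 2 * Real.pi * (1 + freqNormSq k) *
          ‖mFourierCoeff (EuclideanSpace.complexify ∘ laplacian a) k‖ :=
        norm_mFourierCoeff_complexify_partialDeriv_le ha.laplacian j k
    _ ≤ 2 * Real.pi * (1 + freqNormSq k) *
          (4 * Real.pi ^ 2 * (1 + freqNormSq k) * ‖mFourierCoeff (EuclideanSpace.complexify ∘ a) k‖) :=
        mul_le_mul_of_nonneg_left (norm_mFourierCoeff_complexify_laplacian_le ha k) hw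
    _ = 8 * Real.pi ^ 3 * (1 + freqNormSq k) ^ 2 * ‖mFourierCoeff (EuclideanSpace.complexify ∘ a) k‖ := by
        ring

/-- **Sup norms of derivatives through weighted `ℓ¹` norms of the coefficients**: if the coefficients of a
smooth field `b` are dominated by those of `a` through a polynomial symbol,
`‖b̂(k)‖ ≤ L (1 + |k|²)^m ‖â(k)‖`, and `∑ₖ (1 + |k|²)^m ‖â(k)‖ < ∞`, then
`‖b(x)‖ ≤ L ∑ₖ (1 + |k|²)^m ‖â(k)‖`. [folklore] -/
theorem norm_apply_le_mul_tsum_of_norm_mFourierCoeff_le {b : UnitAddTorus d → EuclideanSpace ℝ d}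
    (hb : IsSmooth b) {L : ℝ} {m : ℕ}
    (hL : ∀ k, ‖mFourierCoeff (EuclideanSpace.complexify ∘ b) k‖ ≤
      L * ((1 + freqNormSq k) ^ m * ‖mFourierCoeff (EuclideanSpace.complexify ∘ a) k‖))
    (hs : Summable fun k : d → ℤ => (1 + freqNormSq k) ^ m * ‖mFourierCoeff (EuclideanSpace.complexify ∘ a) k‖)
    (x : UnitAddTorus d) :
    ‖b x‖ ≤ L * ∑' k : d → ℤ, (1 + freqNormSq k) ^ m * ‖mFourierCoeff (EuclideanSpace.complexify ∘ a) k‖ := by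
  rw [← tsum_mul_left]
  exact (norm_apply_le_tsum_norm_mFourierCoeff hb x).trans
    (Summable.tsum_le_tsum hL (summable_norm_mFourierCoeff_of_isSmooth hb) (hs.mul_left L))

end Sup

/-! ### Sup and Sobolev bounds under a Gevrey bound -/

section Gevrey

variable [DecidableEq d] {σ C : ℝ} {a : UnitAddTorus d → EuclideanSpace ℝ d}

/-- **Sup norm under a Gevrey bound**: `‖a(x)‖ ≤ √C ∑ₖ e^{-σ|k|}`. [folklore] -/
theorem norm_apply_le_of_gevreyBound (hσ : 0 < σ) (ha : IsSmooth a)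
    (h : ∀ S : Finset (d → ℤ), ∑ k ∈ S, Real.exp (2 * σ * Real.sqrt (freqNormSq k)) *
      ‖mFourierCoeff (EuclideanSpace.complexify ∘ a) k‖ ^ 2 ≤ C) (x : UnitAddTorus d) :
    ‖a x‖ ≤ Real.sqrt C * ∑' k : d → ℤ, Real.exp (-(σ * Real.sqrt (freqNormSq k))) := by
  have h1 := norm_apply_le_mul_tsum_of_norm_mFourierCoeff_le (a := a) ha (L := 1) (m := 0)
    (fun k => by rw [pow_zero, one_mul, one_mul])
    (summable_one_add_freqNormSq_pow_mul_norm_of_gevreyBound hσ h 0) x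
  have h2 := tsum_one_add_freqNormSq_pow_mul_norm_le_of_gevreyBound hσ h 0
  simp only [pow_zero, one_mul] at h1 h2
  exact h1.trans h2

/-- **Sup norm of first derivatives under a Gevrey bound**:
`‖∂ⱼa(x)‖ ≤ 2π √C ∑ₖ (1 + |k|²) e^{-σ|k|}`. [folklore] -/
theorem norm_partialDeriv_apply_le_of_gevreyBound (hσ : 0 < σ) (ha : IsSmooth a)
    (h : ∀ S : Finset (d → ℤ), ∑ k ∈ S, Real.exp (2 * σ * Real.sqrt (freqNormSq k)) *
      ‖mFourierCoeff (EuclideanSpace.complexify ∘ a) k‖ ^ 2 ≤ C) (j : d) (x : UnitAddTorus d) :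
    ‖partialDeriv j a x‖ ≤ 2 * Real.pi * Real.sqrt C *
      ∑' k : d → ℤ, (1 + freqNormSq k) * Real.exp (-(σ * Real.sqrt (freqNormSq k))) := by
  have h1 := norm_apply_le_mul_tsum_of_norm_mFourierCoeff_le (a := a) (ha.partialDeriv j)
    (L := 2 * Real.pi) (m := 1)
    (fun k => by rw [pow_one, ← mul_assoc]; exact norm_mFourierCoeff_complexify_partialDeriv_le ha j k)
    (summable_one_add_freqNormSq_pow_mul_norm_of_gevreyBound hσ h 1) x
  have h2 := tsum_one_add_freqNormSq_pow_mul_norm_le_of_gevreyBound hσ h 1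
  simp only [pow_one] at h1 h2
  exact h1.trans ((mul_le_mul_of_nonneg_left h2 (by positivity)).trans (le_of_eq (by ring)))

/-- **Sup norm of the Laplacian under a Gevrey bound**:
`‖Δa(x)‖ ≤ 4π² √C ∑ₖ (1 + |k|²) e^{-σ|k|}`. [folklore] -/
theorem norm_laplacian_apply_le_of_gevreyBound (hσ : 0 < σ) (ha : IsSmooth a)
    (h : ∀ S : Finset (d → ℤ), ∑ k ∈ S, Real.exp (2 * σ * Real.sqrt (freqNormSq k)) *
      ‖mFourierCoeff (EuclideanSpace.complexify ∘ a) k‖ ^ 2 ≤ C) (x : UnitAddTorus d) :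
    ‖laplacian a x‖ ≤ 4 * Real.pi ^ 2 * Real.sqrt C *
      ∑' k : d → ℤ, (1 + freqNormSq k) * Real.exp (-(σ * Real.sqrt (freqNormSq k))) := by
  have h1 := norm_apply_le_mul_tsum_of_norm_mFourierCoeff_le (a := a) ha.laplacian
    (L := 4 * Real.pi ^ 2) (m := 1)
    (fun k => by rw [pow_one, ← mul_assoc]; exact norm_mFourierCoeff_complexify_laplacian_le ha k)
    (summable_one_add_freqNormSq_pow_mul_norm_of_gevreyBound hσ h 1) x
  have h2 := tsum_one_add_freqNormSq_pow_mul_norm_le_of_gevreyBound hσ h 1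
  simp only [pow_one] at h1 h2
  exact h1.trans ((mul_le_mul_of_nonneg_left h2 (by positivity)).trans (le_of_eq (by ring)))

/-- **Sup norm of third derivatives under a Gevrey bound**:
`‖∂ⱼΔa(x)‖ ≤ 8π³ √C ∑ₖ (1 + |k|²)² e^{-σ|k|}`. [folklore] -/
theorem norm_partialDeriv_laplacian_apply_le_of_gevreyBound (hσ : 0 < σ) (ha : IsSmooth a)
    (h : ∀ S : Finset (d → ℤ), ∑ k ∈ S, Real.exp (2 * σ * Real.sqrt (freqNormSq k)) *
      ‖mFourierCoeff (EuclideanSpace.complexify ∘ a) k‖ ^ 2 ≤ C) (j : d) (x : UnitAddTorus d) :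
    ‖partialDeriv j (laplacian a) x‖ ≤ 8 * Real.pi ^ 3 * Real.sqrt C *
      ∑' k : d → ℤ, (1 + freqNormSq k) ^ 2 * Real.exp (-(σ * Real.sqrt (freqNormSq k))) := by
  have h1 := norm_apply_le_mul_tsum_of_norm_mFourierCoeff_le (a := a) (ha.laplacian.partialDeriv j)
    (L := 8 * Real.pi ^ 3) (m := 2)
    (fun k => by rw [← mul_assoc]; exact norm_mFourierCoeff_complexify_partialDeriv_laplacian_le ha j k)
    (summable_one_add_freqNormSq_pow_mul_norm_of_gevreyBound hσ h 2) x
  have h2 := tsum_one_add_freqNormSq_pow_mul_norm_le_of_gevreyBound hσ h 2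
  exact h1.trans ((mul_le_mul_of_nonneg_left h2 (by positivity)).trans (le_of_eq (by ring)))

/-- **Uniform sup-norm and Sobolev bounds on a Gevrey ball** (Foias–Temam 1989 Gevrey classes; the
elementary direction "analytic ⇒ bounded in every `H^s`"): for `σ > 0` and `C` there is `B = B(σ, C, d)`
such that every smooth `v : T^d → ℝ^d` with `∑_{k∈S} e^{2σ|k|} ‖v̂(k)‖² ≤ C` for all finite `S ⊆ ℤ^d`
satisfies `‖v(x)‖ ≤ B`, `‖∂ᵢv(x)‖ ≤ B`, `‖∇v‖₂² ≤ B`, `∫ ‖Δv‖² ≤ B`, `‖∇Δv‖₂² ≤ B` and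
`∑_{k∈S} (1 + |k|²)⁴ ‖v̂(k)‖² ≤ B` for all finite `S`. [folklore] -/
theorem exists_sobolevBounds_of_gevreyBound (hσ : 0 < σ) (C : ℝ) :
    ∃ B : ℝ, ∀ (v : UnitAddTorus d → EuclideanSpace ℝ d), IsSmooth v →
      (∀ S : Finset (d → ℤ), ∑ k ∈ S, Real.exp (2 * σ * Real.sqrt (freqNormSq k)) *
        ‖mFourierCoeff (EuclideanSpace.complexify ∘ v) k‖ ^ 2 ≤ C) →
      (∀ x, ‖v x‖ ≤ B) ∧ (∀ i, ∀ x, ‖partialDeriv i v x‖ ≤ B) ∧ gradNormSq v ≤ B ∧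
      (∫ x, ‖laplacian v x‖ ^ 2) ≤ B ∧ gradNormSq (laplacian v) ≤ B ∧
      ∀ S : Finset (d → ℤ), ∑ k ∈ S, (1 + freqNormSq k) ^ 4 *
        ‖mFourierCoeff (EuclideanSpace.complexify ∘ v) k‖ ^ 2 ≤ B := by
  -- the lattice sums and the constants
  set Z₀ : ℝ := ∑' k : d → ℤ, Real.exp (-(σ * Real.sqrt (freqNormSq k)))
  set Z₁ : ℝ := ∑' k : d → ℤ, (1 + freqNormSq k) * Real.exp (-(σ * Real.sqrt (freqNormSq k)))
  set Z₂ : ℝ := ∑' k : d → ℤ, (1 + freqNormSq k) ^ 2 * Real.exp (-(σ * Real.sqrt (freqNormSq k)))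
  set Y₄ : ℝ := ∑' k : d → ℤ, (1 + freqNormSq k) ^ 4 * Real.exp (-(2 * σ * Real.sqrt (freqNormSq k)))
   
  have hZ₀0 : 0 ≤ Z₀ := tsum_nonneg fun k => (Real.exp_pos _).le
  have hZ₁0 : 0 ≤ Z₁ := tsum_nonneg fun k =>
    mul_nonneg (zero_le_one.trans (one_le_one_add_freqNormSq k)) (Real.exp_pos _).le
  have hZ₂0 : 0 ≤ Z₂ := tsum_nonneg fun k =>
    mul_nonneg (one_add_freqNormSq_pow_nonneg k 2) (Real.exp_pos _).le
  have hY₄0 : 0 ≤ Y₄ := tsum_nonneg fun k =>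
    mul_nonneg (one_add_freqNormSq_pow_nonneg k 4) (Real.exp_pos _).le
  set M₀ : ℝ := Real.sqrt C * Z₀
  set M₁ : ℝ := 2 * Real.pi * Real.sqrt C * Z₁
  set M₂ : ℝ := 4 * Real.pi ^ 2 * Real.sqrt C * Z₁
  set M₃ : ℝ := 8 * Real.pi ^ 3 * Real.sqrt C * Z₂
  have hM₀0 : 0 ≤ M₀ := mul_nonneg (Real.sqrt_nonneg C) hZ₀0
  have hM₁0 : 0 ≤ M₁ := mul_nonneg (mul_nonneg (by positivity) (Real.sqrt_nonneg C)) hZ₁0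
  have hcard : 0 ≤ (Fintype.card d : ℝ) * M₁ ^ 2 := by positivity
  have hM₂2 : 0 ≤ M₂ ^ 2 := sq_nonneg _
  have hcard' : 0 ≤ (Fintype.card d : ℝ) * M₃ ^ 2 := by positivity
  refine ⟨M₀ + M₁ + Fintype.card d * M₁ ^ 2 + M₂ ^ 2 + Fintype.card d * M₃ ^ 2 + C * Y₄,
    fun v hv hG => ?_⟩
  have hC : 0 ≤ C := gevreyBound_nonneg hG
  have hCY : 0 ≤ C * Y₄ := mul_nonneg hC hY₄0
  have h0 : ∀ x, ‖v x‖ ≤ M₀ := fun x => norm_apply_le_of_gevreyBound hσ hv hG x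
  have h1 : ∀ i x, ‖partialDeriv i v x‖ ≤ M₁ := fun i x =>
    norm_partialDeriv_apply_le_of_gevreyBound hσ hv hG i x
  have h2 : ∀ x, ‖laplacian v x‖ ≤ M₂ := fun x => norm_laplacian_apply_le_of_gevreyBound hσ hv hG x
  have h3 : ∀ i x, ‖partialDeriv i (laplacian v) x‖ ≤ M₃ := fun i x =>
    norm_partialDeriv_laplacian_apply_le_of_gevreyBound hσ hv hG i x
  have hgrad : gradNormSq v ≤ Fintype.card d * M₁ ^ 2 := gradNormSq_le_of_forall_norm_partialDeriv_le h1
  have hlap : ∫ x, ‖laplacian v x‖ ^ 2 ≤ M₂ ^ 2 := integral_norm_sq_le_of_forall_norm_le h2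
  have hgrad' : gradNormSq (laplacian v) ≤ Fintype.card d * M₃ ^ 2 :=
    gradNormSq_le_of_forall_norm_partialDeriv_le h3
  have hsob : ∀ S : Finset (d → ℤ), ∑ k ∈ S, (1 + freqNormSq k) ^ 4 *
      ‖mFourierCoeff (EuclideanSpace.complexify ∘ v) k‖ ^ 2 ≤ C * Y₄ := fun S =>
    sum_one_add_freqNormSq_pow_mul_norm_sq_le_of_gevreyBound hσ hG 4 S
  refine ⟨fun x => (h0 x).trans ?_, fun i x => (h1 i x).trans ?_, hgrad.trans ?_, hlap.trans ?_,
    hgrad'.trans ?_, fun S => (hsob S).trans ?_⟩ <;> linarith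

end Gevrey

end Torus

end Literature.Analysis.FunctionSpaces

end
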